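import Summits.Schanuel.Schanuel.Theorems.RootDecomp1KGeneric06
import Summits.Schanuel.Schanuel.Theorems.RootDecomp1KGeneric02
import Mathlib.Analysis.SpecificLimits.Normed

/-!
# RootDecomp1K — «GENERIC CELLS», part 08: Piece KS (Kummer specialisation) — the specialisation `kspec`, its fibres, non-vanishing, and two-point value estimates

Provenance: ROOT DECOMPOSITION CELL decomp-schanuel (D-0178), lens 6 «barrier-complement carving»,
gen 13, Stage D; source `KS.lean` (lens publication dir `decomp-schanuel-lens-6/g13/addendum/`).
Supports `stmt-Schanuel-33363` (A₄ʰ `HyperLiouvilleSchanuel`) via the glued split of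
`Theorems/RootDecomp1KGeneric02` (`hyperLiouvilleSchanuel_live_of_pieces`): this series of parts 08–11
PROVES Piece KS (`KummerSpecialisation`, `@[conjecture] def` of part 01) outright.

Contents: §1 integer multiples of rational MvPolynomials; §2 `kspec P D p q = q^D P(V^q, p/q, V^p)`, value,
degree, length, fibres, exponent injectivity `q a + p b` (p, q coprime), `kspec_ne_zero`; §3 Lipschitz-type
estimates for monomials and polynomial values at two nearby points.
-/

noncomputable section

open Complex Polynomial

namespace Summit.Schanuel.Schanuel.Theorems.RootDecomp1KGeneric

open Summit.Schanuel.Schanuel.Theorems.RootDecomp1KHyper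
open Summit.Schanuel.Schanuel.Theorems.RootDecomp1KHyper.HyperCell

/-! ## KS 1. Integer multiples of rational polynomials in several variables -/

open MvPolynomial in
/-- Every rational polynomial has a nonzero integer multiple with integer coefficients. -/
private theorem exists_int_mul_mvPolynomial {σ : Type*} (P : MvPolynomial σ ℚ) :
    ∃ (c : ℤ) (Q : MvPolynomial σ ℤ), c ≠ 0 ∧
      MvPolynomial.map (Int.castRingHom ℚ) Q = MvPolynomial.C (c : ℚ) * P := by
  induction P using MvPolynomial.induction_on with
  | C a =>
    refine ⟨(a.den : ℤ), MvPolynomial.C a.num, by exact_mod_cast a.den_ne_zero, ?_⟩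
    rw [MvPolynomial.map_C, eq_intCast, ← map_mul]
    congr 1
    push_cast
    rw [mul_comm, Rat.mul_den_eq_num]
  | add P₁ P₂ hP₁ hP₂ =>
    obtain ⟨c₁, Q₁, hc₁, h₁⟩ := hP₁
    obtain ⟨c₂, Q₂, hc₂, h₂⟩ := hP₂
    refine ⟨c₁ * c₂, MvPolynomial.C c₂ * Q₁ + MvPolynomial.C c₁ * Q₂, mul_ne_zero hc₁ hc₂, ?_⟩
    rw [map_add, map_mul, map_mul, MvPolynomial.map_C, MvPolynomial.map_C, h₁, h₂]
    simp only [eq_intCast, Int.cast_mul, map_mul]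
    ring
  | mul_X P n hP =>
    obtain ⟨c, Q, hc, h⟩ := hP
    refine ⟨c, Q * MvPolynomial.X n, hc, ?_⟩
    rw [map_mul, MvPolynomial.map_X, h, mul_assoc]

open MvPolynomial in
/-- A finite family of rational polynomials has a COMMON nonzero integer multiplier. -/
theorem exists_common_int_mul_mvPolynomial {σ : Type*} {L : ℕ}
    (P : Fin (L + 1) → MvPolynomial σ ℚ) :
    ∃ (c : ℤ) (Q : Fin (L + 1) → MvPolynomial σ ℤ), c ≠ 0 ∧
      ∀ l, MvPolynomial.map (Int.castRingHom ℚ) (Q l) = MvPolynomial.C (c : ℚ) * P l := by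
  choose c Q hc hQ using fun l => exists_int_mul_mvPolynomial (P l)
  refine ⟨∏ l, c l, fun l => MvPolynomial.C (∏ l' ∈ Finset.univ.erase l, c l') * Q l,
    Finset.prod_ne_zero_iff.2 fun l _ => hc l, fun l => ?_⟩
  rw [map_mul, MvPolynomial.map_C, hQ l, ← mul_assoc, ← map_mul, eq_intCast,
    ← Finset.prod_erase_mul _ _ (Finset.mem_univ l)]
  push_cast
  ring

/-! ## KS 2. The Kummer specialisation `x₀ ↦ V^q, x₁ ↦ p/q, x₂ ↦ V^p` of a 3-variable polynomial -/

/-- The ℓ¹-size of an integer polynomial in several variables. -/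
def lenMv (P : MvPolynomial (Fin 3) ℤ) : ℤ := ∑ s ∈ P.support, |P.coeff s|

/-- The length `lenMv P` (sum of the absolute values of the integer coefficients) is nonnegative. -/
theorem lenMv_nonneg (P : MvPolynomial (Fin 3) ℤ) : 0 ≤ lenMv P :=
  Finset.sum_nonneg fun _ _ => abs_nonneg _

/-- `kspec P D p q = q^D · P(V^q, p/q, V^p) ∈ ℤ[V]` (for `D ≥ deg_{x₁} P`). -/
def kspec (P : MvPolynomial (Fin 3) ℤ) (D p q : ℕ) : ℤ[X] :=
  ∑ s ∈ P.support, C (P.coeff s * (p : ℤ) ^ (s 1) * (q : ℤ) ^ (D - s 1)) * X ^ (q * s 0 + p * s 2)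

/-- Value of the Kummer specialisation: `kspec P D p q` at `v` equals `q^D · P(v^q, p/q, v^p)` (for `D ≥ deg_{x₁} P`, `q ≠ 0`). -/
theorem aeval_kspec (P : MvPolynomial (Fin 3) ℤ) {D : ℕ} (hD : ∀ s ∈ P.support, s 1 ≤ D)
    (p : ℕ) {q : ℕ} (hq : q ≠ 0) (v : ℂ) :
    aeval v (kspec P D p q) = (q : ℂ) ^ D * MvPolynomial.aeval ![v ^ q, (p : ℂ) / q, v ^ p] P := by
  rw [MvPolynomial.aeval_def, MvPolynomial.eval₂_eq', Finset.mul_sum, kspec, map_sum]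
  refine Finset.sum_congr rfl fun s hs => ?_
  rw [map_mul, aeval_C, map_pow, aeval_X, algebraMap_int_eq, eq_intCast]
  simp only [Fin.prod_univ_three, Matrix.cons_val_zero, Matrix.cons_val_one, Matrix.cons_val_two,
    Matrix.tail_cons, Matrix.head_cons, eq_intCast, Int.cast_mul, Int.cast_pow, Int.cast_natCast]
  have hq' : (q : ℂ) ≠ 0 := by exact_mod_cast hq
  have h1 : ((p : ℂ) / q) ^ (s 1) * (q : ℂ) ^ D = (p : ℂ) ^ (s 1) * (q : ℂ) ^ (D - s 1) := by
    rw [div_pow, ← Nat.sub_add_cancel (hD s hs), pow_add, Nat.add_sub_cancel]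
    field_simp
  have e1 : v ^ (q * s 0 + p * s 2) = (v ^ q) ^ (s 0) * (v ^ p) ^ (s 2) := by
    rw [pow_add, pow_mul, pow_mul]
  rw [e1]
  linear_combination (-((P.coeff s : ℤ) : ℂ)) * (v ^ q) ^ (s 0) * (v ^ p) ^ (s 2) * h1

/-- Degree bound `deg (kspec P D p q) ≤ (q + p) · E` when the `x₀`- and `x₂`-exponents of `P` are at most `E`. -/
theorem natDegree_kspec_le (P : MvPolynomial (Fin 3) ℤ) (D p q : ℕ) {E : ℕ}
    (hE : ∀ s ∈ P.support, s 0 ≤ E ∧ s 2 ≤ E) : (kspec P D p q).natDegree ≤ (q + p) * E := by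
  unfold kspec
  refine natDegree_sum_le_of_forall_le _ _ fun s hs => (natDegree_C_mul_X_pow_le _ _).trans ?_
  obtain ⟨h0, h2⟩ := hE s hs
  nlinarith

/-- Elementary bound `p^e · q^(D-e) ≤ (p + q)^D` for `e ≤ D`. -/
theorem pow_mul_pow_le_add_pow (p q : ℕ) {D e : ℕ} (he : e ≤ D) :
    (p : ℤ) ^ e * (q : ℤ) ^ (D - e) ≤ ((p : ℤ) + q) ^ D := by
  calc (p : ℤ) ^ e * (q : ℤ) ^ (D - e) ≤ ((p : ℤ) + q) ^ e * ((p : ℤ) + q) ^ (D - e) := by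
        gcongr <;> linarith
    _ = ((p : ℤ) + q) ^ D := by rw [← pow_add, Nat.add_sub_cancel' he]

/-- The ℓ¹-norm of `kspec P D p q` is at most `lenMv P · (p + q)^D`. -/
theorem len_kspec_le (P : MvPolynomial (Fin 3) ℤ) {D : ℕ} (hD : ∀ s ∈ P.support, s 1 ≤ D)
    (p q : ℕ) : len (kspec P D p q) ≤ lenMv P * ((p : ℤ) + q) ^ D := by
  unfold len
  set N := (kspec P D p q).natDegree
  have hcoeff : ∀ j, |(kspec P D p q).coeff j| ≤
      ∑ s ∈ P.support, if j = q * s 0 + p * s 2 then |P.coeff s| * ((p : ℤ) + q) ^ D else 0 := by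
    intro j
    rw [kspec, finsetSum_coeff]
    refine (Finset.abs_sum_le_sum_abs _ _).trans (Finset.sum_le_sum fun s hs => ?_)
    rw [coeff_C_mul, coeff_X_pow]
    split_ifs with h
    · rw [mul_one, abs_mul, abs_mul, abs_of_nonneg (by positivity : (0 : ℤ) ≤ (p : ℤ) ^ (s 1)),
        abs_of_nonneg (by positivity : (0 : ℤ) ≤ (q : ℤ) ^ (D - s 1)), mul_assoc]
      exact mul_le_mul_of_nonneg_left (pow_mul_pow_le_add_pow p q (hD s hs)) (abs_nonneg _)
    · simp
  calc ∑ j ∈ Finset.range (N + 1), |(kspec P D p q).coeff j|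
      ≤ ∑ j ∈ Finset.range (N + 1), ∑ s ∈ P.support,
          (if j = q * s 0 + p * s 2 then |P.coeff s| * ((p : ℤ) + q) ^ D else 0) :=
        Finset.sum_le_sum fun j _ => hcoeff j
    _ = ∑ s ∈ P.support, ∑ j ∈ Finset.range (N + 1),
          (if j = q * s 0 + p * s 2 then |P.coeff s| * ((p : ℤ) + q) ^ D else 0) :=
        Finset.sum_comm
    _ ≤ ∑ s ∈ P.support, |P.coeff s| * ((p : ℤ) + q) ^ D := by
        refine Finset.sum_le_sum fun s _ => ?_
        rw [Finset.sum_ite_eq']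
        split_ifs
        · exact le_rfl
        · positivity
    _ = lenMv P * ((p : ℤ) + q) ^ D := by rw [lenMv, Finset.sum_mul]

/-- The fibre polynomial `Σ_{s : s₀ = i, s₂ = k} coeff_s · X^{s₁} ∈ ℤ[X]`. -/
def fibre (P : MvPolynomial (Fin 3) ℤ) (i k : ℕ) : ℤ[X] :=
  ∑ s ∈ P.support, if s 0 = i ∧ s 2 = k then C (P.coeff s) * X ^ (s 1) else 0

/-- Coefficient formula for the fibre polynomial `fibre P i k` (the `x₁`-polynomial collecting the monomials of `P` with `x₀`-exponent `i` and `x₂`-exponent `k`). -/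
theorem coeff_fibre (P : MvPolynomial (Fin 3) ℤ) (i k j : ℕ) :
    (fibre P i k).coeff j = ∑ s ∈ P.support, if s 0 = i ∧ s 2 = k ∧ s 1 = j then P.coeff s else 0 := by
  rw [fibre, finsetSum_coeff]
  refine Finset.sum_congr rfl fun s _ => ?_
  by_cases h : s 0 = i ∧ s 2 = k
  · rw [if_pos h, coeff_C_mul, coeff_X_pow]
    by_cases hj : s 1 = j
    · rw [if_pos hj.symm, if_pos ⟨h.1, h.2, hj⟩, mul_one]
    · rw [if_neg (fun e => hj e.symm), if_neg (fun h' => hj h'.2.2), mul_zero]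
  · rw [if_neg h, coeff_zero, if_neg (fun h' => h ⟨h'.1, h'.2.1⟩)]

/-- A finsupp on `Fin 3` is determined by its three values. -/
private theorem finsupp_fin3_ext {s t : Fin 3 →₀ ℕ} (h0 : s 0 = t 0) (h1 : s 1 = t 1) (h2 : s 2 = t 2) :
    s = t := by
  ext i; fin_cases i <;> assumption

/-- The fibre polynomial through a support point of `P` is nonzero. -/
theorem fibre_ne_zero (P : MvPolynomial (Fin 3) ℤ) {t : Fin 3 →₀ ℕ} (ht : t ∈ P.support) :
    fibre P (t 0) (t 2) ≠ 0 := by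
  intro h
  have hc := congrArg (fun f : ℤ[X] => f.coeff (t 1)) h
  simp only [coeff_fibre, coeff_zero] at hc
  rw [Finset.sum_eq_single t] at hc
  · rw [if_pos ⟨rfl, rfl, rfl⟩] at hc
    exact (MvPolynomial.mem_support_iff.mp ht) hc
  · intro s _ hst
    rw [if_neg]
    rintro ⟨h0, h2, h1⟩
    exact hst (finsupp_fin3_ext h0 h1 h2)
  · intro h; exact absurd ht h

/-- Degree bound `deg (fibre P i k) ≤ D` when the `x₁`-exponents of `P` are at most `D`. -/
theorem natDegree_fibre_le (P : MvPolynomial (Fin 3) ℤ) (i k : ℕ) {D : ℕ}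
    (hD : ∀ s ∈ P.support, s 1 ≤ D) : (fibre P i k).natDegree ≤ D := by
  unfold fibre
  refine natDegree_sum_le_of_forall_le _ _ fun s hs => ?_
  split_ifs
  · exact (natDegree_C_mul_X_pow_le _ _).trans (hD s hs)
  · simp

/-- Exponent injectivity: `q s₀ + p s₂ = q i + p k` with `s₂, k < q`, `p ⊥ q` forces `(s₀,s₂) = (i,k)`. -/
theorem kummer_exponent_inj {p q : ℕ} (hpq : Nat.Coprime p q) {a b i k : ℕ} (hb : b < q) (hk : k < q)
    (h : q * a + p * b = q * i + p * k) : a = i ∧ b = k := by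
  have hbk : b = k := by
    have h1 : (p * b) % q = (p * k) % q := by
      have := congrArg (· % q) h
      simpa [Nat.add_mod, Nat.mul_mod_right] using this
    have h2 : b % q = k % q := Nat.ModEq.cancel_left_of_coprime
      (by simpa [Nat.coprime_comm] using hpq) h1
    rwa [Nat.mod_eq_of_lt hb, Nat.mod_eq_of_lt hk] at h2
  subst hbk
  have hq : 0 < q := by omega
  refine ⟨?_, rfl⟩
  have : q * a = q * i := by omega
  exact Nat.eq_of_mul_eq_mul_left hq this

/-- For `p, q` coprime and `x₂`-exponents `< q`, the coefficient of `V^(q i + p k)` in `kspec P D p q` is the scaled value `scaleEval (fibre P i k) D p q` of the `(i, k)`-fibre. -/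
theorem coeff_kspec_fibre (P : MvPolynomial (Fin 3) ℤ) {D p q : ℕ} (hpq : Nat.Coprime p q)
    (hq : ∀ s ∈ P.support, s 2 < q) (hD : ∀ s ∈ P.support, s 1 ≤ D) {i k : ℕ} (hk : k < q) :
    (kspec P D p q).coeff (q * i + p * k) = scaleEval (fibre P i k) D p q := by
  rw [kspec, finsetSum_coeff, scaleEval]
  simp only [coeff_C_mul, coeff_X_pow, coeff_fibre, Finset.sum_mul]
  rw [Finset.sum_comm]
  refine Finset.sum_congr rfl fun s hs => ?_
  by_cases h : s 0 = i ∧ s 2 = k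
  · rw [if_pos (by rw [h.1, h.2]), mul_one, Finset.sum_eq_single (s 1)]
    · rw [if_pos ⟨h.1, h.2, rfl⟩]
    · intro j _ hj; rw [if_neg (fun h' => hj h'.2.2.symm), zero_mul, zero_mul]
    · intro hn; exact absurd (Finset.mem_range.2 (Nat.lt_succ_of_le (hD s hs))) hn
  · rw [if_neg, mul_zero]
    · symm
      refine Finset.sum_eq_zero fun j _ => ?_
      rw [if_neg (fun h' => h ⟨h'.1, h'.2.1⟩), zero_mul, zero_mul]
    · intro heq
      exact h (kummer_exponent_inj hpq (hq s hs) hk heq.symm)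

/-- Non-vanishing of the Kummer specialisation for denominators beyond every fibre's `denBound`. -/
theorem kspec_ne_zero (P : MvPolynomial (Fin 3) ℤ) {t : Fin 3 →₀ ℕ} (ht : t ∈ P.support) {D : ℕ}
    (hD : ∀ s ∈ P.support, s 1 ≤ D) (r : ℚ) {p : ℕ} (hp : (p : ℤ) = r.num)
    (hq : ∀ s ∈ P.support, s 2 < r.den) (hden : denBound (fibre P (t 0) (t 2)) ≤ r.den) :
    kspec P D p r.den ≠ 0 := by
  intro h
  have hc := congrArg (fun f : ℤ[X] => f.coeff (r.den * t 0 + p * t 2)) h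
  have hcop : Nat.Coprime p r.den := by
    have := r.reduced
    rwa [← hp, Int.natAbs_natCast] at this
  simp only [coeff_zero] at hc
  rw [coeff_kspec_fibre P hcop hq hD (hq t ht), hp] at hc
  exact scaleEval_ne_zero (fibre_ne_zero P ht) (natDegree_fibre_le P _ _ hD) r hden hc

/-! ## KS 3. Two-point closeness of monomials and of polynomial values -/

/-- If `‖z‖ ≤ M` with `1 ≤ M` and `e ≤ E` then `‖z^e‖ ≤ M^E`. -/
theorem norm_pow_le_pow_of_le {z : ℂ} {M : ℝ} (hz : ‖z‖ ≤ M) (hM : 1 ≤ M) {e E : ℕ} (he : e ≤ E) :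
    ‖z ^ e‖ ≤ M ^ E := by
  rw [norm_pow]
  exact (pow_le_pow_left₀ (norm_nonneg _) hz _).trans (pow_le_pow_right₀ hM he)

/-- Two-point bound `‖a^e − b^e‖ ≤ E · M^E · ‖a − b‖` for `‖a‖, ‖b‖ ≤ M`, `1 ≤ M`, `e ≤ E`. -/
theorem norm_pow_sub_pow_le' {a b : ℂ} {M : ℝ} (hM : 1 ≤ M) (ha : ‖a‖ ≤ M) (hb : ‖b‖ ≤ M)
    {e E : ℕ} (he : e ≤ E) : ‖a ^ e - b ^ e‖ ≤ E * M ^ E * ‖a - b‖ := by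
  refine (norm_pow_sub_pow_le a b e).trans ?_
  have hmax : max 1 (max ‖a‖ ‖b‖) ≤ M := max_le hM (max_le ha hb)
  have h1 : (max 1 (max ‖a‖ ‖b‖)) ^ e ≤ M ^ E :=
    (pow_le_pow_left₀ (by positivity) hmax _).trans (pow_le_pow_right₀ hM he)
  have h2 : (e : ℝ) ≤ E := by exact_mod_cast he
  have h3 : (0 : ℝ) ≤ M ^ E := by positivity
  gcongr

/-- Two-point closeness of a monomial in three variables inside the polydisc of radius `M ≥ 1`. -/
theorem norm_mono_sub_mono_le {E : ℕ} {M : ℝ} (hM : 1 ≤ M) (x y : Fin 3 → ℂ)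
    (hx : ∀ i, ‖x i‖ ≤ M) (hy : ∀ i, ‖y i‖ ≤ M) (s : Fin 3 →₀ ℕ) (hs : ∀ i, s i ≤ E) :
    ‖(∏ i, x i ^ s i) - ∏ i, y i ^ s i‖ ≤ E * M ^ (3 * E) * ∑ i, ‖x i - y i‖ := by
  rw [Fin.prod_univ_three, Fin.prod_univ_three, Fin.sum_univ_three]
  have hd : ∀ i, ‖x i ^ s i - y i ^ s i‖ ≤ E * M ^ E * ‖x i - y i‖ :=
    fun i => norm_pow_sub_pow_le' hM (hx i) (hy i) (hs i)
  have hnx : ∀ i, ‖x i ^ s i‖ ≤ M ^ E := fun i => norm_pow_le_pow_of_le (hx i) hM (hs i)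
  have hny : ∀ i, ‖y i ^ s i‖ ≤ M ^ E := fun i => norm_pow_le_pow_of_le (hy i) hM (hs i)
  have key : x 0 ^ s 0 * x 1 ^ s 1 * x 2 ^ s 2 - y 0 ^ s 0 * y 1 ^ s 1 * y 2 ^ s 2 =
      (x 0 ^ s 0 - y 0 ^ s 0) * x 1 ^ s 1 * x 2 ^ s 2 + y 0 ^ s 0 * (x 1 ^ s 1 - y 1 ^ s 1) * x 2 ^ s 2
        + y 0 ^ s 0 * y 1 ^ s 1 * (x 2 ^ s 2 - y 2 ^ s 2) := by ring
  rw [key]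
  refine (norm_add₃_le).trans ?_
  rw [norm_mul, norm_mul, norm_mul, norm_mul, norm_mul, norm_mul]
  have hME : (0 : ℝ) ≤ M ^ E := by positivity
  have h3 : M ^ (3 * E) = M ^ E * M ^ E * M ^ E := by
    rw [← pow_add, ← pow_add]; ring_nf
  calc ‖x 0 ^ s 0 - y 0 ^ s 0‖ * ‖x 1 ^ s 1‖ * ‖x 2 ^ s 2‖
        + ‖y 0 ^ s 0‖ * ‖x 1 ^ s 1 - y 1 ^ s 1‖ * ‖x 2 ^ s 2‖
        + ‖y 0 ^ s 0‖ * ‖y 1 ^ s 1‖ * ‖x 2 ^ s 2 - y 2 ^ s 2‖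
      ≤ (E * M ^ E * ‖x 0 - y 0‖) * M ^ E * M ^ E + M ^ E * (E * M ^ E * ‖x 1 - y 1‖) * M ^ E
        + M ^ E * M ^ E * (E * M ^ E * ‖x 2 - y 2‖) := by
        gcongr
        · exact hd 0
        · exact hnx 1
        · exact hnx 2
        · exact hny 0
        · exact hd 1
        · exact hnx 2
        · exact hny 0
        · exact hny 1
        · exact hd 2
    _ = E * M ^ (3 * E) * (‖x 0 - y 0‖ + ‖x 1 - y 1‖ + ‖x 2 - y 2‖) := by rw [h3]; ring

/-- Two-point closeness of the value of an integer polynomial in three variables. -/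
theorem norm_mvAeval_sub_le (P : MvPolynomial (Fin 3) ℤ) {E : ℕ}
    (hE : ∀ s ∈ P.support, ∀ i, s i ≤ E) {M : ℝ} (hM : 1 ≤ M) (x y : Fin 3 → ℂ)
    (hx : ∀ i, ‖x i‖ ≤ M) (hy : ∀ i, ‖y i‖ ≤ M) :
    ‖MvPolynomial.aeval x P - MvPolynomial.aeval y P‖ ≤
      lenMv P * (E * M ^ (3 * E) * ∑ i, ‖x i - y i‖) := by
  rw [MvPolynomial.aeval_def, MvPolynomial.aeval_def, MvPolynomial.eval₂_eq',
    MvPolynomial.eval₂_eq', ← Finset.sum_sub_distrib, lenMv]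
  push_cast
  rw [Finset.sum_mul]
  refine (norm_sum_le _ _).trans (Finset.sum_le_sum fun s hs => ?_)
  rw [← mul_sub, norm_mul, algebraMap_int_eq, eq_intCast, Complex.norm_intCast]
  exact mul_le_mul_of_nonneg_left (norm_mono_sub_mono_le hM x y hx hy s (hE s hs)) (abs_nonneg _)

/-- `|e^a − e^b| ≤ |e^b| · 2|a − b|` for `|a − b| ≤ 1`. -/
theorem norm_cexp_sub_cexp_le {a b : ℂ} (h : ‖a - b‖ ≤ 1) :
    ‖cexp a - cexp b‖ ≤ ‖cexp b‖ * (2 * ‖a - b‖) := by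
  have e : cexp a - cexp b = cexp b * (cexp (a - b) - 1) := by
    rw [mul_sub, mul_one, ← Complex.exp_add, add_sub_cancel]
  rw [e, norm_mul]
  exact mul_le_mul_of_nonneg_left (Complex.norm_exp_sub_one_le h) (norm_nonneg _)

end Summit.Schanuel.Schanuel.Theorems.RootDecomp1KGeneric
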